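import Literature.AnabelianGeometry.AbsoluteAnabelian.AbsCuspCohomologyKerOfOneCusp
import HarnessLib

/-!
# [AbsTopIII] Prop. 1.6 (iii) for Kummer classes of units, EXTRINSIC cyclotome (F-0343): cusp
# induction + Galois-class law (proof-only companion of `CuspidalCyclotome.lean`)

Mochizuki, *Topics in Absolute Anabelian Geometry III*, §1, Prop. 1.6 (iii) p. 35 (manuscript pages, lit
key `paper:url-5493eb38cbb7`): "`1 → (k^×)^∧ → H¹(Π_U, M_X) → ⊕_{x ∈ S} Ẑ` [...] the image of
`Γ(U, 𝒪_U^×)` [...] determined by the principal divisors".  `AbsTopIII.Prop_1_6_iii_units M` (FACT-LIST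
F-0343, relative to `M : KummerCurveModel`, cyclotome realised EXTRINSICALLY as `geomCyclotome` inside
`Π_{U_x}/[N, Δ]⁻`) says: a regular unit has vanishing Kummer class on every cuspidal inertia group iff it is
constant.  Universal closure refuted (f-078, p428690).

The intrinsic twin F-0375 was decomposed in `KummerProp16iiiUnitsOfLaws.lean` (kernel form F-0378 ∘ law
(KC)).  THIS FILE gives the extrinsic row the SAME decomposition, the extrinsic kernel form being supplied
by the cusp induction of `AbsCuspCohomologyKerOfOneCusp.lean` ([AbsCusp] Prop. 2.1 (ii)): F-0343 holds at
every model from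

* [AbsTopIII] Prop. 1.4 (i), second clause, BY NAME (`M.toCurveModel.Prop_1_4_i'`, F-0340);
* the inertia-transport law (TR) and the one-cusp law (WT_x) (GAP-LEDGER G-w6d075g4-5 and G-w6d075g4-6; here with
  the guards of F-0343: Kummer-faithful base instead of MLF base);
* the extrinsic Galois-class law (KC′) «`κ_U(f)|_{Δ_U} = 0` iff `f` is constant» (print: `Ker res_{Δ_U} =
  (k^×)^∧`; Kummer theory of `U_{k̄}`), the extrinsic reading of GAP-LEDGER G-w6d075g4-4 —

all binders, no new `Prop` fact; and conversely F-0343 together with the kernel form returns (KC′).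
HONEST FRAMING: typed ≠ proved for genuine curves; nothing here bears on [IUTchIII] Cor. 3.12.
-/

noncomputable section

open CategoryTheory
open scoped Classical

namespace Literature.AnabelianGeometry.AbsoluteAnabelian.AbsTopIII

universe u

namespace KummerCurveModel

variable (M : KummerCurveModel.{u})

/-- **Extrinsic kernel form at the model by cusp induction**: for a presentation `U ⊆ U_x ⊆ X` of
`M : KummerCurveModel` with `U` scheme-like and `(U_x, x)` a cyclotome presentation, a class of
`H¹(Π_U, M_X)` (extrinsic) dies on every cuspidal inertia group of `U` iff it dies on `Δ_U` — from
Prop. 1.4 (i) BY NAME, (TR) and the one-cusp law (WT_x) (the latter two under the guards of F-0343).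
[cite: MochizukiAbsTopIII2015, Prop 1.6 (iii) p.35] -/
theorem geomCyclotomeH1Res_icusp_iff_geom (h14 : M.toCurveModel.Prop_1_4_i')
    (htr : ∀ (U Ux X : M.Curve) (h₁ : M.IsCofiniteOpen U Ux) (h₂ : M.IsCofiniteOpen Ux X)
      (x : (M.cusps Ux).Cusp), M.IsScheme U → M.IsCyclotomePresentation h₂ x →
      ∀ g ∈ (M.cusps Ux).Icusp x, ∃ s : (M.cusps U).Cusp, ∃ g' ∈ (M.cusps U).Icusp s,
        (M.res h₁).arith g' = g)
    (h1 : ∀ (U Ux X : M.Curve) (_ : M.IsCofiniteOpen U Ux) (h₂ : M.IsCofiniteOpen Ux X)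
      (x : (M.cusps Ux).Cusp), M.IsScheme U → M.IsCyclotomePresentation h₂ x →
      IsKummerFaithful (M.base U) →
      AbsCusp.Prop_2_1_ii_ker (𝟙 (M.ext Ux)) (M.res h₂) (fun _ : PUnit.{u + 1} => (M.cusps Ux).Icusp x))
    {U Ux X : M.Curve} (h₁ : M.IsCofiniteOpen U Ux) (h₂ : M.IsCofiniteOpen Ux X)
    (x : (M.cusps Ux).Cusp) (hU : M.IsScheme U) (hpres : M.IsCyclotomePresentation h₂ x)
    (hk : IsKummerFaithful (M.base U)) (c : geomCyclotomeH1 (M.res h₁) (M.res h₂)) :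
    (∀ y : (M.cusps U).Cusp, geomCyclotomeH1Res (M.res h₁) (M.res h₂) ((M.cusps U).Icusp y) c = 0) ↔
      geomCyclotomeH1Res (M.res h₁) (M.res h₂) (M.ext U).geom c = 0 := by
  obtain ⟨hsurj, -, S₁, hker⟩ := h14 U Ux h₁ hU hpres.isScheme.1
  refine ⟨fun hc => ?_, fun hc y => ?_⟩
  · exact AbsCusp.prop_2_1_ii_mp_of_oneCusp (M.res h₁) (M.res h₂) hsurj
      (fun y : (M.cusps U).Cusp => (M.cusps U).Icusp y) (fun y => (M.cusps U).Icusp_le_geom y) hker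
      (fun _ : PUnit.{u + 1} => (M.cusps Ux).Icusp x)
      (fun _ g hg => htr U Ux X h₁ h₂ x hU hpres g hg) (h1 U Ux X h₁ h₂ x hU hpres hk) c hc
  · exact AbsCusp.prop_2_1_ii_ker_mpr (M.res h₁) (M.res h₂)
      (fun y : (M.cusps U).Cusp => (M.cusps U).Icusp y) (fun y => (M.cusps U).Icusp_le_geom y) c hc y

/-- **F-0343 `Prop_1_6_iii_units M` (extrinsic) at every `M : KummerCurveModel` from Prop. 1.4 (i) BY NAME,
(TR), (WT_x) and the extrinsic Galois-class law (KC′)** «the Kummer class of a regular unit dies on `Δ_U`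
iff the unit is constant» — the same decomposition as the intrinsic F-0375
(`IntrinsicKummerModel.prop_1_6_iii_units_of_laws`). [cite: MochizukiAbsTopIII2015, Prop 1.6 (iii) p.35] -/
theorem prop_1_6_iii_units_of_laws (h14 : M.toCurveModel.Prop_1_4_i')
    (htr : ∀ (U Ux X : M.Curve) (h₁ : M.IsCofiniteOpen U Ux) (h₂ : M.IsCofiniteOpen Ux X)
      (x : (M.cusps Ux).Cusp), M.IsScheme U → M.IsCyclotomePresentation h₂ x →
      ∀ g ∈ (M.cusps Ux).Icusp x, ∃ s : (M.cusps U).Cusp, ∃ g' ∈ (M.cusps U).Icusp s,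
        (M.res h₁).arith g' = g)
    (h1 : ∀ (U Ux X : M.Curve) (_ : M.IsCofiniteOpen U Ux) (h₂ : M.IsCofiniteOpen Ux X)
      (x : (M.cusps Ux).Cusp), M.IsScheme U → M.IsCyclotomePresentation h₂ x →
      IsKummerFaithful (M.base U) →
      AbsCusp.Prop_2_1_ii_ker (𝟙 (M.ext Ux)) (M.res h₂) (fun _ : PUnit.{u + 1} => (M.cusps Ux).Icusp x))
    (hKC : ∀ (U Ux X : M.Curve) (h₁ : M.IsCofiniteOpen U Ux) (h₂ : M.IsCofiniteOpen Ux X)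
      (x : (M.cusps Ux).Cusp), M.IsScheme U → M.IsCyclotomePresentation h₂ x →
      IsKummerFaithful (M.base U) → (∀ c : (M.cusps U).Cusp, (M.cusps U).IsRational c) →
      ∀ f : M.regularUnits U,
        geomCyclotomeH1Res (M.res h₁) (M.res h₂) (M.ext U).geom
            (Multiplicative.toAdd (M.kummer h₁ h₂ f)) = 0 ↔
          ((f : (M.FunctionField U)ˣ) : M.FunctionField U) ∈
            Set.range (algebraMap (M.base U) (M.FunctionField U))) :
    Literature.AnabelianGeometry.AbsoluteAnabelian.AbsTopIII.Prop_1_6_iii_units M := by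
  intro U Ux X h₁ h₂ x hU hpres hk hrat f
  exact (M.geomCyclotomeH1Res_icusp_iff_geom h14 htr h1 h₁ h₂ x hU hpres hk _).trans
    (hKC U Ux X h₁ h₂ x hU hpres hk hrat f)

/-- Conversely, F-0343 together with the extrinsic kernel form gives back the law (KC′); so, given
Prop. 1.4 (i), (TR) and (WT_x), F-0343 is EQUIVALENT to (KC′). [cite: MochizukiAbsTopIII2015, Prop 1.6 (iii) p.35] -/
theorem galoisConstLaw_of_prop_1_6_iii_units (h14 : M.toCurveModel.Prop_1_4_i')
    (htr : ∀ (U Ux X : M.Curve) (h₁ : M.IsCofiniteOpen U Ux) (h₂ : M.IsCofiniteOpen Ux X)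
      (x : (M.cusps Ux).Cusp), M.IsScheme U → M.IsCyclotomePresentation h₂ x →
      ∀ g ∈ (M.cusps Ux).Icusp x, ∃ s : (M.cusps U).Cusp, ∃ g' ∈ (M.cusps U).Icusp s,
        (M.res h₁).arith g' = g)
    (h1 : ∀ (U Ux X : M.Curve) (_ : M.IsCofiniteOpen U Ux) (h₂ : M.IsCofiniteOpen Ux X)
      (x : (M.cusps Ux).Cusp), M.IsScheme U → M.IsCyclotomePresentation h₂ x →
      IsKummerFaithful (M.base U) →
      AbsCusp.Prop_2_1_ii_ker (𝟙 (M.ext Ux)) (M.res h₂) (fun _ : PUnit.{u + 1} => (M.cusps Ux).Icusp x))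
    (hunits : Literature.AnabelianGeometry.AbsoluteAnabelian.AbsTopIII.Prop_1_6_iii_units M)
    (U Ux X : M.Curve) (h₁ : M.IsCofiniteOpen U Ux) (h₂ : M.IsCofiniteOpen Ux X)
    (x : (M.cusps Ux).Cusp) (hU : M.IsScheme U) (hpres : M.IsCyclotomePresentation h₂ x)
    (hk : IsKummerFaithful (M.base U)) (hrat : ∀ c : (M.cusps U).Cusp, (M.cusps U).IsRational c)
    (f : M.regularUnits U) :
    geomCyclotomeH1Res (M.res h₁) (M.res h₂) (M.ext U).geom
        (Multiplicative.toAdd (M.kummer h₁ h₂ f)) = 0 ↔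
      ((f : (M.FunctionField U)ˣ) : M.FunctionField U) ∈
        Set.range (algebraMap (M.base U) (M.FunctionField U)) :=
  (M.geomCyclotomeH1Res_icusp_iff_geom h14 htr h1 h₁ h₂ x hU hpres hk _).symm.trans
    (hunits U Ux X h₁ h₂ x hU hpres hk hrat f)

end KummerCurveModel

end Literature.AnabelianGeometry.AbsoluteAnabelian.AbsTopIII
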